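import Summits.AtomisticToContinuum.BoseEinsteinCondensation.Theorems.BECThomsonPrincipleFibreConductanceStubLocalToGlobalHelpers
import HarnessLib

/-!
# Route `BECThomsonPrinciple`, crux `FibreConductance` (stmt-AtomisticToContinuum-9480),
# line `conditional-law-poincare` — stub `stub_localToGlobal`, part II: LOCAL-TO-GLOBAL IN DUAL FORM

`stub_localToGlobal : Goal.stub_localToGlobal` (`= WeightedSobolevPoincare → LocalToGlobal`,
`…FibreConductanceConditionalDefs`): given the weighted Sobolev–Poincaré tool on the tiling cubes
(constant `C < ∞`; landed as `weightedSobolevPoincare_cubeSet`, `…StubWeightedSobolevPoincare`), for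
EVERY zero-free periodic `C¹` state `Φ` (`L > 0`), every block count `ν`, every CONTINUOUS charge `ρ`
and every level `B`: a dual bound `‖∫ρ_cη‖² ≤ B·E(η)` of the coarse part `ρ_c = ψ²c_Q/μ_Q` gives
`‖∫ρη‖² ≤ (2C·sobolevLevelOf ρ + 2B)·E(η)` for all test `η`, `E(η) = ∫|∇₀η|²ψ²/W`.

Proof. By part I, `∫ρη = ∫ρ_loc(η − Πη) + ∫ρ_cη` EXACTLY (the cross term `∫ρ_loc·Πη` vanishes by
cube neutrality). The high part (`ltg_high_fibre`, `ltg_high_sq_le`): on each cube flat Cauchy–Schwarz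
`∫_Q|ρ_loc||η − ⨍_Qη| ≤ U_Q^{1/2}‖η(X[0↦·]) − ⨍_Q‖_{L²(Q)}`, the weighted Sobolev–Poincaré bound with
weight `w = ψ(X[0↦·])²` (its right side is the cube energy `∫_Q|∇₀η|²ψ²` by the slice chain rule
`ltg_fderiv_fibre`, its hole integral is `holeFactor`), Cauchy–Schwarz over the cubes
(`Σ_Q (U_QP_Q)^{1/2}V_Q^{1/2} ≤ S^{1/2}b^{1/2}`) and over the bath with weights `W`, `1/W`
(`∫ S·W = L³·sobolevLevelOf`, `∫ b/W = L³·E`) — c1's `high_sq_le` pattern with the local Poincaré field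
replaced by the Sobolev hole factor `(∫_Qψ⁻³)^{2/3}`. Finally `‖a + b‖² ≤ 2‖a‖² + 2‖b‖²`.

References: the line's skeleton `Cruxes/FibreConductance/Lines/conditional_law_poincare.lean`;
R. Lyons, Y. Peres, *Probability on Trees and Networks* (2016) Ch. 2 §2.4 and G. Grimmett, H. Kesten,
Y. Zhang (1993) §2 — ideas only; LSSY2005 Lemma 4.1 for the Sobolev step (landed separately). All
[folklore].
-/

noncomputable section

namespace Summit.AtomisticToContinuum.BoseEinsteinCondensation.Cruxes.FibreConductance.ConditionalLawPoincare

open MeasureTheory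
open scoped ENNReal
open Literature.MathematicalPhysics.QuantumManyBody.BoseGas
open Summit.AtomisticToContinuum.BoseEinsteinCondensation.Cruxes.FibreConductance.ParsevalShellBootstrap
open Summit.AtomisticToContinuum.BoseEinsteinCondensation.Cruxes.FibreConductance.HealingSplitKineticDefect

variable {m : ℕ} {L : ℝ}

/-! ### The high part: flat Cauchy–Schwarz on cubes and the weighted Sobolev–Poincaré tool

(Notation-free: the block average is `cubeAvg L ν η (cubeIdx L ν (X 0)) X`; the fibre energy
`b(X̂) = ∫_cell |∇₀η|²ψ² dy` and the Sobolev fibre sum `S(X̂) = Σ_Q U_Q P_Q` are written out.) -/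

section HighPart

open Set

variable {ρ : Config (m + 1) → ℂ}

/-- Chain rule for fibre slices at particle `0`: `∂_l (y ↦ η(X[0 ↦ y])) = (∂_{0,l}η)(X[0 ↦ y])`.
[folklore] -/
theorem ltg_fderiv_fibre {η : Config (m + 1) → ℂ} (hη : Differentiable ℝ η) (X : Config (m + 1))
    (y : Space) (l : Fin 3) :
    fderiv ℝ (fun z : Space => η (Function.update X 0 z)) y (EuclideanSpace.single l 1) =
      fderiv ℝ η (Function.update X 0 y) (e0 m l) := by
  have h := ((hη _).hasFDerivAt.comp y (hasFDerivAt_update X (i := (0 : Fin (m + 1))) y)).fderiv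
  rw [show (fun z : Space => η (Function.update X 0 z)) = η ∘ Function.update X 0 from rfl, h,
    ContinuousLinearMap.comp_apply]
  congr 1
  funext i
  simp only [ContinuousLinearMap.pi_apply, HealingSplitKineticDefect.e0]
  rcases eq_or_ne i 0 with rfl | hi
  · simp
  · simp [hi]

/-- `ofReal (Σ_l ‖v_l‖²) = Σ_l ‖v_l‖₊²` in `ℝ≥0∞`. [folklore] -/
theorem ltg_ofReal_sum_norm_sq (v : Fin 3 → ℂ) :
    ENNReal.ofReal (∑ l, ‖v l‖ ^ 2) = ∑ l, (‖v l‖₊ : ℝ≥0∞) ^ 2 := by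
  rw [ENNReal.ofReal_sum_of_nonneg fun l _ => sq_nonneg _]
  refine Finset.sum_congr rfl fun l _ => ?_
  rw [ENNReal.ofReal_pow (norm_nonneg _), ofReal_norm, enorm_eq_nnnorm]

/-- The weighted gradient of a fibre slice is the fibre energy density:
`ofReal(ψ²)·|∇(y ↦ η(X[0↦y]))|² = ofReal(|∇₀η|²ψ²)`. [folklore] -/
theorem ltg_weight_mul_gradSqC {η : Config (m + 1) → ℂ} (hη : Differentiable ℝ η)
    (Φ : PeriodicTrialState (m + 1) L) (X : Config (m + 1)) (y : Space) :
    ENNReal.ofReal (fibrePsi Φ (Function.update X 0 y) ^ 2) *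
        gradSqC (fun z : Space => η (Function.update X 0 z)) y =
      ENNReal.ofReal ((∑ l : Fin 3, ‖fderiv ℝ η (Function.update X 0 y) (e0 m l)‖ ^ 2) * fibrePsi Φ (Function.update X 0 y) ^ 2) := by
  simp only [gradSqC, ltg_fderiv_fibre hη]
  rw [← ltg_ofReal_sum_norm_sq, ← ENNReal.ofReal_mul (sq_nonneg _), mul_comm]

/-- The flat cube average is the average over the cube: `cubeAvg L ν η Q X = ⨍_Q η(X[0 ↦ ·])`.
[folklore] -/
theorem cubeAvg_eq_setAverage (hL : 0 < L) (ν : ℕ) (η : Config (m + 1) → ℂ)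
    (Q : Fin 3 → Fin (ν + 1)) (X : Config (m + 1)) :
    cubeAvg L ν η Q X = ⨍ z in cubeSet L ν Q, η (Function.update X 0 z) := by
  rw [setAverage_eq, cubeAvg, volume_real_cubeSet hL, inv_pow]

/-- `ofReal ‖ab‖ = (‖a‖ₑ²)^{1/2} (‖b‖ₑ²)^{1/2}`. [folklore] -/
theorem ltg_ofReal_norm_mul (a b : ℂ) :
    ENNReal.ofReal ‖a * b‖ = (‖a‖ₑ ^ 2) ^ (1 / 2 : ℝ) * (‖b‖ₑ ^ 2) ^ (1 / 2 : ℝ) := by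
  have e : ∀ y : ℝ≥0∞, (y ^ 2) ^ (1 / 2 : ℝ) = y := fun y => by
    rw [← ENNReal.rpow_natCast, ← ENNReal.rpow_mul]; norm_num
  rw [e, e, norm_mul, ENNReal.ofReal_mul (norm_nonneg _), ofReal_norm, ofReal_norm]

/-- **Per-fibre bound of the high part**: with a weighted Sobolev–Poincaré constant `C`,
`∫_cell |ρ_loc|·|η − Πη| dy ≤ C^{1/2} · S(X̂)^{1/2} · b(X̂)^{1/2}` (flat Cauchy–Schwarz on each cube,
the weighted Sobolev–Poincaré bound with weight `ψ²`, Cauchy–Schwarz over the cubes). [folklore] -/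
theorem ltg_high_fibre (hL : 0 < L) {ν : ℕ} (Φ : PeriodicTrialState (m + 1) L)
    (hΦ : ∀ X, Φ.ψ X ≠ 0) (hlm : Measurable (localOf L ν Φ ρ)) {C : ℝ≥0∞}
    (hPS : ∀ (Q : Fin 3 → Fin (ν + 1)) (f : Space → ℂ), ContDiff ℝ 1 f →
      ∀ w : Space → ℝ, Continuous w → (∀ y, 0 < w y) →
        ∫⁻ y in cubeSet L ν Q, ‖f y - ⨍ z in cubeSet L ν Q, f z‖ₑ ^ 2 ≤
          C * (∫⁻ y in cubeSet L ν Q, ENNReal.ofReal (w y) * gradSqC f y) *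
            (∫⁻ y in cubeSet L ν Q, ENNReal.ofReal (w y ^ (-(3 / 2 : ℝ)))) ^ (2 / 3 : ℝ))
    {η : Config (m + 1) → ℂ} (hη : IsTest L η) (X : Config (m + 1)) :
    ∫⁻ y in cell L, ENNReal.ofReal ‖localOf L ν Φ ρ (Function.update X 0 y) *
        (η (Function.update X 0 y) - cubeAvg L ν η (cubeIdx L ν (Function.update X 0 y 0)) (Function.update X 0 y))‖ ≤
      C ^ (1 / 2 : ℝ) * (∑ Q : Fin 3 → Fin (ν + 1), localSqOf L ν Φ ρ Q X * holeFactor L ν Φ Q X) ^ (1 / 2 : ℝ) * (∫⁻ y in cell L, ENNReal.ofReal ((∑ l : Fin 3, ‖fderiv ℝ η (Function.update X 0 y) (e0 m l)‖ ^ 2) * fibrePsi Φ (Function.update X 0 y) ^ 2)) ^ (1 / 2 : ℝ) := by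
  have h2 : (0 : ℝ) ≤ 1 / 2 := by norm_num
  have hu : Continuous fun y : Space => Function.update X 0 y := continuous_const.update 0 continuous_id
  have hηd : Differentiable ℝ η := hη.1.differentiable one_ne_zero
  have hψu := (continuous_fibrePsi hL Φ hΦ).comp hu
  have hηu : Continuous fun y : Space => η (Function.update X 0 y) := hη.1.continuous.comp hu
  -- the cube energies
  set V : (Fin 3 → Fin (ν + 1)) → ℝ≥0∞ := fun Q => ∫⁻ y in cubeSet L ν Q, ENNReal.ofReal
    ((∑ l : Fin 3, ‖fderiv ℝ η (Function.update X 0 y) (e0 m l)‖ ^ 2) * fibrePsi Φ (Function.update X 0 y) ^ 2) with hV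
  have hb : (∫⁻ y in cell L, ENNReal.ofReal ((∑ l : Fin 3, ‖fderiv ℝ η (Function.update X 0 y) (e0 m l)‖ ^ 2) * fibrePsi Φ (Function.update X 0 y) ^ 2)) = ∑ Q, V Q := lintegral_cell_eq_sum hL ν _
  -- per cube: flat Cauchy–Schwarz and the weighted Sobolev–Poincaré bound
  have hcube : ∀ Q, ∫⁻ y in cubeSet L ν Q, ENNReal.ofReal ‖localOf L ν Φ ρ (Function.update X 0 y) *
      (η (Function.update X 0 y) - cubeAvg L ν η (cubeIdx L ν (Function.update X 0 y 0)) (Function.update X 0 y))‖ ≤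
      C ^ (1 / 2 : ℝ) * ((localSqOf L ν Φ ρ Q X * holeFactor L ν Φ Q X) ^ (1 / 2 : ℝ) *
        V Q ^ (1 / 2 : ℝ)) := by
    intro Q
    -- the Sobolev–Poincaré bound for the slice `f = η(X[0 ↦ ·])` with weight `ψ²`
    have hf : ContDiff ℝ 1 fun z : Space => η (Function.update X 0 z) :=
      hη.1.comp (contDiff_update_zero.comp (contDiff_id.prodMk contDiff_const))
    have hw : Continuous fun z : Space => fibrePsi Φ (Function.update X 0 z) ^ 2 := hψu.pow 2
    have hw0 : ∀ z, 0 < fibrePsi Φ (Function.update X 0 z) ^ 2 := fun z =>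
      pow_pos (fibrePsi_pos hL Φ hΦ _) 2
    have hP := hPS Q _ hf _ hw hw0
    have hVQ : ∫⁻ y in cubeSet L ν Q, ENNReal.ofReal (fibrePsi Φ (Function.update X 0 y) ^ 2) *
        gradSqC (fun z : Space => η (Function.update X 0 z)) y = V Q :=
      setLIntegral_congr_fun (measurableSet_cubeSet L ν Q) fun y _ => ltg_weight_mul_gradSqC hηd Φ X y
    rw [hVQ] at hP
    -- `hP : ∫_Q ‖f − ⨍f‖ₑ² ≤ C * V Q * holeFactor`
    have hP' : ∫⁻ y in cubeSet L ν Q, ‖η (Function.update X 0 y) - cubeAvg L ν η Q X‖ₑ ^ 2 ≤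
        C * V Q * holeFactor L ν Φ Q X := by
      rw [cubeAvg_eq_setAverage hL ν η Q X]
      exact hP
    have hmeasU : Measurable fun y : Space => ‖localOf L ν Φ ρ (Function.update X 0 y)‖ₑ ^ 2 :=
      (hlm.comp hu.measurable).enorm.pow_const 2
    have hmeasG : Measurable fun y : Space => ‖η (Function.update X 0 y) - cubeAvg L ν η Q X‖ₑ ^ 2 :=
      (hηu.sub continuous_const).measurable.enorm.pow_const 2
    calc ∫⁻ y in cubeSet L ν Q, ENNReal.ofReal ‖localOf L ν Φ ρ (Function.update X 0 y) *
          (η (Function.update X 0 y) - cubeAvg L ν η (cubeIdx L ν (Function.update X 0 y 0)) (Function.update X 0 y))‖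
        = ∫⁻ y in cubeSet L ν Q, (‖localOf L ν Φ ρ (Function.update X 0 y)‖ₑ ^ 2) ^ (1 / 2 : ℝ) *
            (‖η (Function.update X 0 y) - cubeAvg L ν η Q X‖ₑ ^ 2) ^ (1 / 2 : ℝ) :=
          setLIntegral_congr_fun (measurableSet_cubeSet L ν Q) fun y hy => by
            rw [blockAvg_update hL X hy, ltg_ofReal_norm_mul]
      _ ≤ (localSqOf L ν Φ ρ Q X) ^ (1 / 2 : ℝ) * (∫⁻ y in cubeSet L ν Q,
            ‖η (Function.update X 0 y) - cubeAvg L ν η Q X‖ₑ ^ 2) ^ (1 / 2 : ℝ) :=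
          lintegral_sqrt_mul_sqrt_le _ hmeasU.aemeasurable hmeasG.aemeasurable
      _ ≤ (localSqOf L ν Φ ρ Q X) ^ (1 / 2 : ℝ) * (C * V Q * holeFactor L ν Φ Q X) ^ (1 / 2 : ℝ) := by
          gcongr
      _ = _ := by
          simp only [ENNReal.mul_rpow_of_nonneg _ _ h2]
          ring
  -- sum over the cubes
  have hsplit : ∫⁻ y in cell L, ENNReal.ofReal ‖localOf L ν Φ ρ (Function.update X 0 y) *
        (η (Function.update X 0 y) - cubeAvg L ν η (cubeIdx L ν (Function.update X 0 y 0)) (Function.update X 0 y))‖ =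
      ∑ Q, ∫⁻ y in cubeSet L ν Q, ENNReal.ofReal ‖localOf L ν Φ ρ (Function.update X 0 y) *
        (η (Function.update X 0 y) - cubeAvg L ν η (cubeIdx L ν (Function.update X 0 y 0)) (Function.update X 0 y))‖ :=
    lintegral_cell_eq_sum hL ν _
  calc _ = _ := hsplit
    _ ≤ ∑ Q, C ^ (1 / 2 : ℝ) * ((localSqOf L ν Φ ρ Q X * holeFactor L ν Φ Q X) ^ (1 / 2 : ℝ) *
          V Q ^ (1 / 2 : ℝ)) := Finset.sum_le_sum fun Q _ => hcube Q
    _ = C ^ (1 / 2 : ℝ) * ∑ Q, (localSqOf L ν Φ ρ Q X * holeFactor L ν Φ Q X) ^ (1 / 2 : ℝ) *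
          V Q ^ (1 / 2 : ℝ) := by rw [← Finset.mul_sum]
    _ ≤ C ^ (1 / 2 : ℝ) * ((∑ Q : Fin 3 → Fin (ν + 1), localSqOf L ν Φ ρ Q X * holeFactor L ν Φ Q X) ^ (1 / 2 : ℝ) * (∑ Q, V Q) ^ (1 / 2 : ℝ)) := by
        gcongr
        exact sum_sqrt_mul_sqrt_le _ _ _
    _ = _ := by rw [hb, mul_assoc]

/-- The Sobolev fibre sum `S(X̂)` is measurable in the configuration. [folklore] -/
theorem ltg_measurable_sobF (hL : 0 < L) (ν : ℕ) (Φ : PeriodicTrialState (m + 1) L)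
    (hΦ : ∀ X, Φ.ψ X ≠ 0) (hlm : Measurable (localOf L ν Φ ρ)) :
    Measurable fun X : Config (m + 1) => (∑ Q : Fin 3 → Fin (ν + 1), localSqOf L ν Φ ρ Q X * holeFactor L ν Φ Q X) := by
  have hu : Continuous fun p : Config (m + 1) × Space => Function.update p.1 0 p.2 :=
    continuous_fst.update 0 continuous_snd
  refine Finset.measurable_sum _ fun Q _ => ?_
  have hU : Measurable fun X => localSqOf L ν Φ ρ Q X := by
    have h1 : Measurable fun p : Config (m + 1) × Space =>
        ‖localOf L ν Φ ρ (Function.update p.1 0 p.2)‖ₑ ^ 2 :=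
      (hlm.comp hu.measurable).enorm.pow_const 2
    exact h1.lintegral_prod_right' (ν := volume.restrict (cubeSet L ν Q))
  have hP : Measurable fun X => holeFactor L ν Φ Q X := by
    have h1 : Measurable fun p : Config (m + 1) × Space =>
        ENNReal.ofReal ((fibrePsi Φ (Function.update p.1 0 p.2) ^ 2) ^ (-(3 / 2 : ℝ))) :=
      ((((continuous_fibrePsi hL Φ hΦ).comp hu).pow 2).measurable.pow_const _).ennreal_ofReal
    exact (h1.lintegral_prod_right' (ν := volume.restrict (cubeSet L ν Q))).pow_const _
  exact hU.mul hP

/-- `∫_{cellN} S·W = L³ · sobolevLevelOf`. [folklore] -/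
theorem ltg_lintegral_sobF_mul (hL : 0 < L) (ν : ℕ) (Φ : PeriodicTrialState (m + 1) L)
    (ρ : Config (m + 1) → ℂ) :
    ∫⁻ X in cellN (m + 1) L, (∑ Q : Fin 3 → Fin (ν + 1), localSqOf L ν Φ ρ Q X * holeFactor L ν Φ Q X) * ENNReal.ofReal (fibreW Φ X) =
      ENNReal.ofReal L ^ 3 * sobolevLevelOf L ν Φ ρ := by
  have hc0 : ENNReal.ofReal L ^ 3 ≠ 0 := pow_ne_zero _ (ENNReal.ofReal_pos.2 hL).ne'
  have hct : ENNReal.ofReal L ^ 3 ≠ ⊤ := ENNReal.pow_ne_top ENNReal.ofReal_ne_top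
  rw [sobolevLevelOf, ← mul_assoc, ENNReal.mul_inv_cancel hc0 hct, one_mul]

/-- **The high part**: `‖∫_{cellN} ρ_loc (η − Πη)‖² ≤ C · sobolevLevelOf · dualEnergy`. [folklore] -/
theorem ltg_high_sq_le (hL : 0 < L) {ν : ℕ} (Φ : PeriodicTrialState (m + 1) L)
    (hΦ : ∀ X, Φ.ψ X ≠ 0) (hlm : Measurable (localOf L ν Φ ρ)) {C : ℝ≥0∞} (hCtop : C ≠ ⊤)
    (hPS : ∀ (Q : Fin 3 → Fin (ν + 1)) (f : Space → ℂ), ContDiff ℝ 1 f →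
      ∀ w : Space → ℝ, Continuous w → (∀ y, 0 < w y) →
        ∫⁻ y in cubeSet L ν Q, ‖f y - ⨍ z in cubeSet L ν Q, f z‖ₑ ^ 2 ≤
          C * (∫⁻ y in cubeSet L ν Q, ENNReal.ofReal (w y) * gradSqC f y) *
            (∫⁻ y in cubeSet L ν Q, ENNReal.ofReal (w y ^ (-(3 / 2 : ℝ)))) ^ (2 / 3 : ℝ))
    {η : Config (m + 1) → ℂ} (hη : IsTest L η) :
    ENNReal.ofReal (‖∫ X in cellN (m + 1) L, localOf L ν Φ ρ X * (η X - cubeAvg L ν η (cubeIdx L ν (X 0)) X)‖ ^ 2) ≤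
      C * sobolevLevelOf L ν Φ ρ * dualEnergy Φ η := by
  have h2 : (0 : ℝ) ≤ 1 / 2 := by norm_num
  set c : ℝ≥0∞ := ENNReal.ofReal L ^ 3 with hc
  have hc0 : c ≠ 0 := pow_ne_zero _ (ENNReal.ofReal_pos.2 hL).ne'
  have hct : c ≠ ⊤ := ENNReal.pow_ne_top ENNReal.ofReal_ne_top
  have hmeas : Measurable fun X => ENNReal.ofReal ‖localOf L ν Φ ρ X * (η X - cubeAvg L ν η (cubeIdx L ν (X 0)) X)‖ :=
    (hlm.mul (hη.1.continuous.measurable.sub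
      (measurable_blockAvg hL ν hη.1.continuous))).norm.ennreal_ofReal
  have hW0 : ∀ X, ENNReal.ofReal (fibreW Φ X) ≠ 0 := fun X =>
    (ENNReal.ofReal_pos.2 (fibreW_pos hL Φ hΦ X)).ne'
  have hCh : C ^ (1 / 2 : ℝ) ≠ ⊤ := ENNReal.rpow_ne_top_of_nonneg h2 hCtop
  rw [ENNReal.ofReal_pow (norm_nonneg _)]
  refine sq_le_of_le_sqrt ((ENNReal.mul_le_mul_iff_right hc0 hct).1 ?_)
  calc c * ENNReal.ofReal ‖∫ X in cellN (m + 1) L, localOf L ν Φ ρ X * (η X - cubeAvg L ν η (cubeIdx L ν (X 0)) X)‖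
      ≤ c * ∫⁻ X in cellN (m + 1) L,
          ENNReal.ofReal ‖localOf L ν Φ ρ X * (η X - cubeAvg L ν η (cubeIdx L ν (X 0)) X)‖ := by
        gcongr
        exact ofReal_norm_integral_le _ _
    _ = ∫⁻ X in cellN (m + 1) L, ∫⁻ y in cell L, ENNReal.ofReal
          ‖localOf L ν Φ ρ (Function.update X 0 y) *
            (η (Function.update X 0 y) - cubeAvg L ν η (cubeIdx L ν (Function.update X 0 y 0)) (Function.update X 0 y))‖ :=
        (lintegral_cellN_lintegral_update 0 hmeas).symm
    _ ≤ ∫⁻ X in cellN (m + 1) L, C ^ (1 / 2 : ℝ) *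
          ((∑ Q : Fin 3 → Fin (ν + 1), localSqOf L ν Φ ρ Q X * holeFactor L ν Φ Q X) ^ (1 / 2 : ℝ) * (∫⁻ y in cell L, ENNReal.ofReal ((∑ l : Fin 3, ‖fderiv ℝ η (Function.update X 0 y) (e0 m l)‖ ^ 2) * fibrePsi Φ (Function.update X 0 y) ^ 2)) ^ (1 / 2 : ℝ)) :=
        lintegral_mono fun X => (ltg_high_fibre hL Φ hΦ hlm hPS hη X).trans_eq (mul_assoc _ _ _)
    _ = C ^ (1 / 2 : ℝ) * ∫⁻ X in cellN (m + 1) L,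
          (∑ Q : Fin 3 → Fin (ν + 1), localSqOf L ν Φ ρ Q X * holeFactor L ν Φ Q X) ^ (1 / 2 : ℝ) * (∫⁻ y in cell L, ENNReal.ofReal ((∑ l : Fin 3, ‖fderiv ℝ η (Function.update X 0 y) (e0 m l)‖ ^ 2) * fibrePsi Φ (Function.update X 0 y) ^ 2)) ^ (1 / 2 : ℝ) :=
        lintegral_const_mul' _ _ hCh
    _ ≤ C ^ (1 / 2 : ℝ) *
          ((∫⁻ X in cellN (m + 1) L, (∑ Q : Fin 3 → Fin (ν + 1), localSqOf L ν Φ ρ Q X * holeFactor L ν Φ Q X) * ENNReal.ofReal (fibreW Φ X)) ^ (1 / 2 : ℝ) *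
            (∫⁻ X in cellN (m + 1) L, (∫⁻ y in cell L, ENNReal.ofReal ((∑ l : Fin 3, ‖fderiv ℝ η (Function.update X 0 y) (e0 m l)‖ ^ 2) * fibrePsi Φ (Function.update X 0 y) ^ 2)) * (ENNReal.ofReal (fibreW Φ X))⁻¹) ^
              (1 / 2 : ℝ)) := by
        gcongr
        exact lintegral_sqrt_mul_sqrt_le_weighted _ (ltg_measurable_sobF hL ν Φ hΦ hlm).aemeasurable
          (measurable_energyFibre hL Φ hΦ hη.1).aemeasurable
          (measurable_fibreW Φ).ennreal_ofReal.aemeasurable hW0 fun _ => ENNReal.ofReal_ne_top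
    _ = (c ^ (1 / 2 : ℝ)) ^ 2 * (C ^ (1 / 2 : ℝ) *
          sobolevLevelOf L ν Φ ρ ^ (1 / 2 : ℝ) * dualEnergy Φ η ^ (1 / 2 : ℝ)) := by
        rw [ltg_lintegral_sobF_mul hL ν Φ ρ, lintegral_energyFibre_mul hL Φ hΦ hη.1,
          ENNReal.mul_rpow_of_nonneg _ _ h2, ENNReal.mul_rpow_of_nonneg _ _ h2]
        ring
    _ = _ := by rw [← ENNReal.rpow_natCast, ← ENNReal.rpow_mul]; norm_num

/-! ### The registered stub -/

/-- `‖I₁ + I₂‖² ≤ 2‖I₁‖² + 2‖I₂‖²` in `ℝ≥0∞`. [folklore] -/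
theorem ltg_ofReal_norm_add_sq_le (I₁ I₂ : ℂ) :
    ENNReal.ofReal (‖I₁ + I₂‖ ^ 2) ≤ 2 * ENNReal.ofReal (‖I₁‖ ^ 2) + 2 * ENNReal.ofReal (‖I₂‖ ^ 2) := by
  calc ENNReal.ofReal (‖I₁ + I₂‖ ^ 2) ≤ ENNReal.ofReal (2 * ‖I₁‖ ^ 2 + 2 * ‖I₂‖ ^ 2) := by
        refine ENNReal.ofReal_le_ofReal ?_
        nlinarith [norm_add_le I₁ I₂, norm_nonneg (I₁ + I₂), norm_nonneg I₁, norm_nonneg I₂,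
          sq_nonneg (‖I₁‖ - ‖I₂‖)]
    _ = 2 * ENNReal.ofReal (‖I₁‖ ^ 2) + 2 * ENNReal.ofReal (‖I₂‖ ^ 2) := by
        rw [ENNReal.ofReal_add (by positivity) (by positivity), ENNReal.ofReal_mul zero_le_two,
          ENNReal.ofReal_mul zero_le_two, ENNReal.ofReal_ofNat]

/-- **`stub_localToGlobal` — LOCAL-TO-GLOBAL IN DUAL FORM.** The weighted Sobolev–Poincaré tool on
the tiling cubes (`WeightedSobolevPoincare`, constant `C`) gives, for EVERY zero-free state, block count
`ν`, continuous charge `ρ` and level `B`: a dual bound of the coarse part `ρ_c` at level `B` yields the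
dual bound of `ρ` at level `2C·sobolevLevelOf ρ + 2B`. Proof: `∫ρη = ∫ρ_loc(η − Πη) + ∫ρ_cη` exactly
(the cross term `∫ρ_loc·Πη` vanishes by cube neutrality, `integral_localOf_mul_blockAvg`), the high part
`ltg_high_sq_le` (flat Cauchy–Schwarz per cube, weighted Sobolev–Poincaré with weight `ψ²`,
Cauchy–Schwarz over cubes and over the bath with weights `W`, `1/W`), and
`‖a + b‖² ≤ 2‖a‖² + 2‖b‖²`. (Refs: LyonsPeres2016 Ch. 2 §2.4; GrimmettKestenZhang1993 §2 — ideas only;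
the Sobolev step is LSSY2005 Lemma 4.1's.) [folklore] -/
theorem stub_localToGlobal : Goal.stub_localToGlobal := by
  rintro ⟨C, hCtop, hPS⟩
  refine ⟨C, hCtop, fun m L hL ν Φ hΦ ρ hρ B hB η hη => ?_⟩
  have hPSν := fun Q f hf w hw hw0 => hPS L hL ν Q f hf w hw hw0
  have hI₁ := ltg_high_sq_le hL Φ hΦ (measurable_localOf hL ν Φ hΦ hρ) hCtop hPSν hη
  have hI₂ := hB η hη
  set I₁ := ∫ X in cellN (m + 1) L, localOf L ν Φ ρ X * (η X - cubeAvg L ν η (cubeIdx L ν (X 0)) X)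
  set I₂ := ∫ X in cellN (m + 1) L, coarseOf L ν Φ ρ X * η X
  -- the exact split `∫ρη = I₁ + I₂`
  have hc := hη.1.continuous
  have hlocη := ltg_integrableOn_localOf_mul hL ν Φ hΦ hρ hc
  have hlocP := ltg_integrableOn_localOf_mul_blockAvg hL ν Φ hΦ hρ hc
  have hcoη := ltg_integrableOn_coarseOf_mul hL ν Φ hΦ hρ hc
  have hsplit : ∫ X in cellN (m + 1) L, ρ X * η X = I₁ + I₂ := by
    have h1 : ∫ X in cellN (m + 1) L, ρ X * η X =
        (∫ X in cellN (m + 1) L, localOf L ν Φ ρ X * η X) + I₂ := by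
      rw [← integral_add hlocη hcoη]
      exact integral_congr_ae (Filter.Eventually.of_forall fun X => by simp only [localOf]; ring)
    have h2 : ∫ X in cellN (m + 1) L, localOf L ν Φ ρ X * η X =
        I₁ + ∫ X in cellN (m + 1) L, localOf L ν Φ ρ X * cubeAvg L ν η (cubeIdx L ν (X 0)) X := by
      rw [← integral_add ((hlocη.sub hlocP).congr (Filter.Eventually.of_forall fun X => by
        simp only [Pi.sub_apply]; ring)) hlocP]
      exact integral_congr_ae (Filter.Eventually.of_forall fun X => by ring)
    rw [h1, h2, integral_localOf_mul_blockAvg hL Φ hΦ hρ hc, add_zero]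
  rw [hsplit]
  calc ENNReal.ofReal (‖I₁ + I₂‖ ^ 2)
      ≤ 2 * ENNReal.ofReal (‖I₁‖ ^ 2) + 2 * ENNReal.ofReal (‖I₂‖ ^ 2) := ltg_ofReal_norm_add_sq_le I₁ I₂
    _ ≤ 2 * (C * sobolevLevelOf L ν Φ ρ * dualEnergy Φ η) + 2 * (B * dualEnergy Φ η) := by gcongr
    _ = (2 * C * sobolevLevelOf L ν Φ ρ + 2 * B) * dualEnergy Φ η := by ring

end HighPart

end Summit.AtomisticToContinuum.BoseEinsteinCondensation.Cruxes.FibreConductance.ConditionalLawPoincare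

end
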